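import Literature.NumberTheory.EllipticCurves.SwanConductorFromCertificatesProofs
import HarnessLib

/-!
# The certificate interface at the level of the ring of integers of the explicit field

`Proofs` file (theorems only, no definitions, no named facts) in topic
`NumberTheory/EllipticCurves`, landed by the seat of bsd.S15
(`Literature.NumberTheory.EllipticCurves.conductorNorm_eq_artinConductorNat_of_isElliptic`):
`swanConductorAt_torsion_three_eq_of_certificates` (`SwanConductorFromCertificatesProofs`) takes its
fraction data in the absolute integers `\bar ℤ_K ⊆ K̄` and the prime `𝔓`; a computer algebra system
produces them in `S_F = \bar{𝓞_K}^F` and `𝔔 = 𝔓 ∩ S_F`.  This file transfers: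

* `exists_absIntegers_frac`, `exists_absIntegers_unit_frac` — `z d = n` in `F` with `n, d ∈ S_F`,
  `d ∉ 𝔔` (resp. `n, d ∉ 𝔔`) gives the `\bar ℤ_K`-fractions required at `𝔓`;
* `swanConductorAt_torsion_three_eq_of_certificates_integralClosure` — the one-call interface with
  all data in `S_F`: good-model coefficients and discriminant as `S_F`-fractions, the finset `T` of
  non-trivial inertial elements with indices, and for each `τ ∈ T` the entries of `A_τ` as
  `S_F`-fractions one of whose numerators is `∉ 𝔔`.

## References

* J. H. Silverman, *Advanced Topics in the Arithmetic of Elliptic Curves*, GTM 151 (1994), §IV.10,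
  Thm. IV.11.1 (`p = 2`, PDF p. 366). [SilvermanATAEC1994]
* J.-P. Serre, *Local Fields*, GTM 67 (1979), Ch. IV, Ch. VI §2. [SerreLocalFields1979]

## Design

Theorems only; `noncomputable section`; `namespace WeierstrassCurve`.  Axioms: `propext`,
`Classical.choice`, `Quot.sound`.
-/

noncomputable section

open scoped Classical NNReal NumberField Pointwise
open Field IsDedekindDomain MeasureTheory

universe u

namespace WeierstrassCurve

open Literature.NumberTheory.EllipticCurves Literature.NumberTheory.GaloisRepresentations

variable {K : Type u} [Field K] [NumberField K]

omit [NumberField K] in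
/-- **Fractions transfer to the absolute integers.**  If `z d = n` in `F` with `n, d ∈ S_F` and
`d ∉ 𝔔 = 𝔓 ∩ S_F`, then `z = n'/d'` with `n', d' ∈ \bar ℤ_K`, `d' ∉ 𝔓`. [folklore] -/
theorem exists_absIntegers_frac {𝔓 : Ideal (absIntegers (𝓞 K) K)}
    (F : IntermediateField K (AlgebraicClosure K)) {z : F} {n d : integralClosure (𝓞 K) F}
    (hd : d ∉ 𝔓.comap (F.integralClosureToAbsIntegers (𝓞 K))) (h : z * d = n) :
    ∃ n' d' : absIntegers (𝓞 K) K, d' ∉ 𝔓 ∧ (z : AlgebraicClosure K) * d' = n' := by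
  refine ⟨F.integralClosureToAbsIntegers (𝓞 K) n, F.integralClosureToAbsIntegers (𝓞 K) d,
    fun h' ↦ hd (Ideal.mem_comap.mpr h'), ?_⟩
  change (z : AlgebraicClosure K) * (((d : integralClosure (𝓞 K) F) : F) : AlgebraicClosure K) =
    (((n : integralClosure (𝓞 K) F) : F) : AlgebraicClosure K)
  rw [← h]
  push_cast
  rfl

omit [NumberField K] in
/-- Units transfer likewise: `z d = n` with `n, d ∉ 𝔔` gives `z = n'/d'`, `n', d' ∉ 𝔓`. [folklore] -/
theorem exists_absIntegers_unit_frac {𝔓 : Ideal (absIntegers (𝓞 K) K)}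
    (F : IntermediateField K (AlgebraicClosure K)) {z : F} {n d : integralClosure (𝓞 K) F}
    (hn : n ∉ 𝔓.comap (F.integralClosureToAbsIntegers (𝓞 K)))
    (hd : d ∉ 𝔓.comap (F.integralClosureToAbsIntegers (𝓞 K))) (h : z * d = n) :
    ∃ n' d' : absIntegers (𝓞 K) K, n' ∉ 𝔓 ∧ d' ∉ 𝔓 ∧ (z : AlgebraicClosure K) * d' = n' := by
  obtain ⟨n', d', hd', e⟩ := exists_absIntegers_frac F hd h
  refine ⟨F.integralClosureToAbsIntegers (𝓞 K) n, F.integralClosureToAbsIntegers (𝓞 K) d,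
    fun h' ↦ hn (Ideal.mem_comap.mpr h'), fun h' ↦ hd (Ideal.mem_comap.mpr h'), ?_⟩
  change (z : AlgebraicClosure K) * (((d : integralClosure (𝓞 K) F) : F) : AlgebraicClosure K) =
    (((n : integralClosure (𝓞 K) F) : F) : AlgebraicClosure K)
  rw [← h]
  push_cast
  rfl

variable (W : WeierstrassCurve K)

attribute [local instance] AddSubgroup.torsionBy.zmodModule

set_option maxHeartbeats 800000 in
/-- **`Sw_𝔓(E[3])` from a certificate in `S_F`.**  As
`swanConductorAt_torsion_three_eq_of_certificates`, with every fraction datum given in the ring of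
integers `S_F` of the explicit field and the prime `𝔔 = 𝔓 ∩ S_F`: the good-model coefficients
`a_i' dᵢ = nᵢ` (`dᵢ ∉ 𝔔`), the discriminant `Δ' d = n` (`n, d ∉ 𝔔`), and for `τ ∈ T` the entries of
`A_τ = C (τC)⁻¹` with some numerator `∉ 𝔔`.  Conclusion:
**`Sw_𝔓(E[3]) = 2 (b + Σ_{τ ∈ T} (f(τ) - 1)) / (#T + 1)`**, `b = max f - 1`.
[cite: SilvermanATAEC1994, §IV.10 Definition of δ (PDF p. 358); Thm. IV.11.1, p = 2 (p. 366)]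
[cite: SerreLocalFields1979, Ch. IV §3 Lemma 3 and Ch. VI §2] -/
theorem swanConductorAt_torsion_three_eq_of_certificates_integralClosure [W.IsElliptic]
    {v : HeightOneSpectrum (𝓞 K)} (h3 : (3 : 𝓞 K) ∉ v.asIdeal)
    {𝔓 : Ideal (absIntegers (𝓞 K) K)} (h𝔓 : 𝔓 ∈ v.primesAbove)
    (F : IntermediateField K (AlgebraicClosure K)) [FiniteDimensional K F] [Normal K F]
    (C : VariableChange F)
    (ha₁ : ∃ n d : integralClosure (𝓞 K) F, d ∉ 𝔓.comap (F.integralClosureToAbsIntegers (𝓞 K)) ∧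
      (C • W.baseChange F).a₁ * d = n)
    (ha₂ : ∃ n d : integralClosure (𝓞 K) F, d ∉ 𝔓.comap (F.integralClosureToAbsIntegers (𝓞 K)) ∧
      (C • W.baseChange F).a₂ * d = n)
    (ha₃ : ∃ n d : integralClosure (𝓞 K) F, d ∉ 𝔓.comap (F.integralClosureToAbsIntegers (𝓞 K)) ∧
      (C • W.baseChange F).a₃ * d = n)
    (ha₄ : ∃ n d : integralClosure (𝓞 K) F, d ∉ 𝔓.comap (F.integralClosureToAbsIntegers (𝓞 K)) ∧
      (C • W.baseChange F).a₄ * d = n)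
    (ha₆ : ∃ n d : integralClosure (𝓞 K) F, d ∉ 𝔓.comap (F.integralClosureToAbsIntegers (𝓞 K)) ∧
      (C • W.baseChange F).a₆ * d = n)
    (hΔ : ∃ n d : integralClosure (𝓞 K) F, n ∉ 𝔓.comap (F.integralClosureToAbsIntegers (𝓞 K)) ∧
      d ∉ 𝔓.comap (F.integralClosureToAbsIntegers (𝓞 K)) ∧ (C • W.baseChange F).Δ * d = n)
    (T : Finset (F ≃ₐ[K] F))
    (hT : ∀ τ, τ ∈ T ↔
      τ ∈ (𝔓.comap (F.integralClosureToAbsIntegers (𝓞 K))).inertia (F ≃ₐ[K] F) ∧ τ ≠ 1)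
    (hTne : T.Nonempty) (f : (F ≃ₐ[K] F) → ℕ)
    (hf : ∀ τ ∈ T,
      lowerIndex (𝔓.comap (F.integralClosureToAbsIntegers (𝓞 K))) (F ≃ₐ[K] F) τ = f τ)
    (hA : ∀ τ ∈ T, ∃ nu du nr dr ns ds nt dt : integralClosure (𝓞 K) F,
      du ∉ 𝔓.comap (F.integralClosureToAbsIntegers (𝓞 K)) ∧
      dr ∉ 𝔓.comap (F.integralClosureToAbsIntegers (𝓞 K)) ∧
      ds ∉ 𝔓.comap (F.integralClosureToAbsIntegers (𝓞 K)) ∧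
      dt ∉ 𝔓.comap (F.integralClosureToAbsIntegers (𝓞 K)) ∧
      (((C * (C.map (τ : F →+* F))⁻¹).u : F) - 1) * du = nu ∧
      (C * (C.map (τ : F →+* F))⁻¹).r * dr = nr ∧
      (C * (C.map (τ : F →+* F))⁻¹).s * ds = ns ∧
      (C * (C.map (τ : F →+* F))⁻¹).t * dt = nt ∧
      (nu ∉ 𝔓.comap (F.integralClosureToAbsIntegers (𝓞 K)) ∨
        nr ∉ 𝔓.comap (F.integralClosureToAbsIntegers (𝓞 K)) ∨
        ns ∉ 𝔓.comap (F.integralClosureToAbsIntegers (𝓞 K)) ∨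
        nt ∉ 𝔓.comap (F.integralClosureToAbsIntegers (𝓞 K)))) :
    (W.torsionGaloisRep 3).swanConductorAt (𝓞 K) 𝔓 =
      2 * ((((T.sup f - 1 : ℕ) : ℝ) + ∑ τ ∈ T, ((f τ : ℝ) - 1)) / (T.card + 1)) := by
  set 𝔔 := 𝔓.comap (F.integralClosureToAbsIntegers (𝓞 K)) with h𝔔
  -- transfer the good-model data
  obtain ⟨n₁, d₁, hd₁, e₁⟩ := ha₁
  obtain ⟨n₂, d₂, hd₂, e₂⟩ := ha₂
  obtain ⟨n₃, d₃, hd₃, e₃⟩ := ha₃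
  obtain ⟨n₄, d₄, hd₄, e₄⟩ := ha₄
  obtain ⟨n₆, d₆, hd₆, e₆⟩ := ha₆
  obtain ⟨nΔ, dΔ, hnΔ, hdΔ, eΔ⟩ := hΔ
  refine W.swanConductorAt_torsion_three_eq_of_certificates h3 h𝔓 F C
    (exists_absIntegers_frac F hd₁ e₁) (exists_absIntegers_frac F hd₂ e₂)
    (exists_absIntegers_frac F hd₃ e₃) (exists_absIntegers_frac F hd₄ e₄)
    (exists_absIntegers_frac F hd₆ e₆) (exists_absIntegers_unit_frac F hnΔ hdΔ eΔ)
    T hT hTne f hf fun τ hτ ↦ ?_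
  -- transfer the `A_τ` data
  obtain ⟨nu, du, nr, dr, ns, ds, nt, dt, hdu, hdr, hds, hdt, eu, er, es, et, hunit⟩ := hA τ hτ
  let ι := F.integralClosureToAbsIntegers (𝓞 K)
  have hnot : ∀ {x : integralClosure (𝓞 K) F}, x ∉ 𝔔 → ι x ∉ 𝔓 := fun hx h' ↦
    hx (Ideal.mem_comap.mpr h')
  have hmem : ∀ {x : integralClosure (𝓞 K) F}, ι x ∈ 𝔓 → x ∈ 𝔔 := fun h' ↦ Ideal.mem_comap.mpr h'
  have heq : ∀ {z : F} {n d : integralClosure (𝓞 K) F}, z * d = n →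
      (z : AlgebraicClosure K) * ι d = ι n := by
    intro z n d h
    change (z : AlgebraicClosure K) * (((d : integralClosure (𝓞 K) F) : F) : AlgebraicClosure K) =
      (((n : integralClosure (𝓞 K) F) : F) : AlgebraicClosure K)
    rw [← h]; push_cast; rfl
  have heu : ((((C * (C.map (τ : F →+* F))⁻¹).u : F) : AlgebraicClosure K) - 1) * ι du = ι nu := by
    have := heq eu
    push_cast at this
    exact this
  refine ⟨ι nu, ι du, ι nr, ι dr, ι ns, ι ds, ι nt, ι dt, hnot hdu, hnot hdr, hnot hds, hnot hdt,
    heu, heq er, heq es, heq et, ?_⟩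
  rcases hunit with h | h | h | h
  · exact Or.inl fun h' ↦ h (hmem h')
  · exact Or.inr (Or.inl fun h' ↦ h (hmem h'))
  · exact Or.inr (Or.inr (Or.inl fun h' ↦ h (hmem h')))
  · exact Or.inr (Or.inr (Or.inr fun h' ↦ h (hmem h')))

end WeierstrassCurve

end
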